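import Mathlib.NumberTheory.AbelSummation
import Mathlib.NumberTheory.Chebyshev
import Mathlib.Analysis.SpecialFunctions.Log.InvLog
import Mathlib.Analysis.Complex.ExponentialBounds
import Literature.NumberTheory.LFunctions.PrimeIdealTheorem
import HarnessLib

/-!
# The Chebyshev function `θ_K` of a number field and the last step of the prime ideal theorem

Topic `Literature/NumberTheory/LFunctions` (sibling of `PrimeIdealTheorem.lean`, which states the
named fact `Literature.NumberTheory.LFunctions.NumberField.primeIdealTheorem`:
`|π_K(x) − Li(x)| ≤ C_K x exp(−c_K √log x)` for `x ≥ 2`).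

This file carries out, sorry-free, the *final* step of Landau's proof of the prime ideal theorem
(Landau 1903, Part II, §§13–14, pp. 669–670; Montgomery–Vaughan 2007, Theorem 8.9, p. 267):
the passage from the Chebyshev function
`θ_K(x) = ∑_{N𝔭 ≤ x} log N𝔭` to the prime-ideal counting function `π_K(x)` by partial summation
over Landau's `G(n) = #{𝔭 : N𝔭 = n}`, with the de la Vallée-Poussin error term carried along.
The analytic input — `θ_K(x) = x + O_K(x exp(−c_K √log x))`, which needs the continuation of
`ζ_K` to the left of `Re s = 1`, a zero-free region and a contour argument — is vendored as the
named fact `chebyshevThetaPrimeIdealTheorem`; the tree proves none of its ingredients yet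
(`Literature/NumberTheory/LFunctions/DedekindZeta.lean` is all named facts).

## Content (namespace `Literature.NumberField`)

* `normPrimeIdealCount K n` — Landau's `G(n)`, the number of nonzero prime ideals of `𝓞 K` of
  absolute norm exactly `n` (Landau 1903, p. 669).
* `chebyshevThetaIdeal K x = θ_K(x) = ∑_{n ≤ x} G(n) log n = ∑_{N𝔭 ≤ x} log N𝔭`
  (Landau's `ϑ_κ(x)`, eq. (57), p. 669); the second form is `chebyshevThetaIdeal_eq_sum_primeIdealsLE`.
* `primeIdealCount_eq_sum_normPrimeIdealCount` — `π_K(x) = ∑_{n ≤ x} G(n)`.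
* `primeIdealCount_eq_theta_div_log_add_integral` — partial summation
  `π_K(x) = θ_K(x)/log x + ∫₂ˣ θ_K(t) dt/(t log² t)` for `x ≥ 2` (proved; the `K = ℚ` case is
  Mathlib's `Chebyshev.primeCounting_eq_theta_div_log_add_integral`).
* `offsetLogIntegral_eq_div_log_add_integral` — `Li(x) = x/log x − 2/log 2 + ∫₂ˣ dt/log² t` (proved).
* `chebyshevThetaPrimeIdealTheorem` — NAMED FACT: for every number field `K` there are `c_K > 0`,
  `C_K` with `|θ_K(x) − x| ≤ C_K x exp(−c_K √log x)` for `x ≥ 2`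
  (Montgomery–Vaughan 2007, Theorem 8.9 with Theorem 6.9; Landau 1903 eq. (57) has the weaker
  `O(x exp(−(log x)^{1/γ}))`).
* `primeIdealCount_sub_offsetLogIntegral_le` — PROVED: a bound
  `|θ_K(x) − x| ≤ C x exp(−c√log x)` (`x ≥ 2`, `c > 0`) implies
  `|π_K(x) − Li(x)| ≤ C' x exp(−c'√log x)` (`x ≥ 2`) with `c' = min (c/2) (1/4)` and an explicit `C'`.
* `primeIdealTheorem_of_chebyshevTheta` — PROVED: `chebyshevThetaPrimeIdealTheorem → primeIdealTheorem`.

## On the sources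

Landau's 1903 paper proves `ϑ_κ(x) = x + O(x e^{−(log x)^{1/γ}})` (eq. (57)) and hence
`π_κ(x) = Li(x) + O(x e^{−(log x)^{1/γ}})` for an explicit integer `γ > 2`, and states the prime
ideal theorem in the form "`π_κ(x) ∼ Li(x)`, the relative error tending to `0` faster than every
negative power of `log x`" (p. 670). The de la Vallée-Poussin-quality error `x e^{−c√log x}` for
number fields is Montgomery–Vaughan's Theorem 8.9 (attributed there to Landau's later refinements,
cf. their p. 194). The partial-summation step formalised here is the same in both.

## References

* E. Landau, *Neuer Beweis des Primzahlsatzes und Beweis des Primidealsatzes*, Math. Ann. 56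
  (1903), 645–670, Part II §§9–14 (`LandauMathAnn1903`).
* H. L. Montgomery, R. C. Vaughan, *Multiplicative Number Theory I. Classical Theory*,
  Cambridge Stud. Adv. Math. 97 (2007), Theorem 8.9 (p. 267) and Theorem 6.9
  (`MontgomeryVaughan2007`).
-/

noncomputable section

open scoped NumberField
open Finset Real MeasureTheory

namespace Literature.NumberTheory.LFunctions.NumberField

variable (K : Type*) [Field K] [NumberField K]

/-! ### Landau's `G(n)` and the Chebyshev function `θ_K` -/

/-- Landau's `G(n)`: the number of nonzero prime ideals `𝔭` of `𝓞 K` with absolute norm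
`N𝔭 = n` ("die Anzahl der Darstellungen der ganzen rationalen Zahl `n` als Norm eines
Primideales"; it vanishes unless `n` is a prime power). [cite: LandauMathAnn1903, §13 p. 669] -/
def normPrimeIdealCount (n : ℕ) : ℕ :=
  {P : Ideal (𝓞 K) | P.IsPrime ∧ P ≠ ⊥ ∧ Ideal.absNorm P = n}.ncard

/-- The Chebyshev function of the number field `K`,
`θ_K(x) = ∑_{n ≤ x} G(n) log n = ∑_{N𝔭 ≤ x} log N𝔭` (Landau's `ϑ_κ(x)`; the sum over prime
ideals is `chebyshevThetaIdeal_eq_sum_primeIdealsLE`). For `x < 0` the value is `0`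
(`⌊x⌋₊ = 0` and `G(0) = 0`). [cite: LandauMathAnn1903, eq. (57) p. 669] -/
def chebyshevThetaIdeal (x : ℝ) : ℝ :=
  ∑ n ∈ Icc 0 ⌊x⌋₊, (normPrimeIdealCount K n : ℝ) * Real.log n

/-- The set of nonzero prime ideals of norm exactly `n` is finite (finitely many ideals of each
norm, Mathlib `Ideal.finite_setOf_absNorm_eq`). [folklore] -/
theorem finite_setOf_prime_absNorm_eq (n : ℕ) :
    {P : Ideal (𝓞 K) | P.IsPrime ∧ P ≠ ⊥ ∧ Ideal.absNorm P = n}.Finite := by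
  exact (Ideal.finite_setOf_absNorm_eq (S := 𝓞 K) n).subset fun P hP => hP.2.2

/-- `G(0) = 0`: the only ideal of norm `0` is `⊥`. [folklore] -/
@[simp] theorem normPrimeIdealCount_zero : normPrimeIdealCount K 0 = 0 := by
  rw [normPrimeIdealCount, Set.ncard_eq_zero (finite_setOf_prime_absNorm_eq K 0)]
  ext P
  simp only [Set.mem_setOf_eq, Set.mem_empty_iff_false, iff_false, not_and]
  intro _ hP h0
  exact hP (Ideal.absNorm_eq_zero_iff.mp h0)

/-- `G(1) = 0`: the only ideal of norm `1` is `⊤`, which is not prime. [folklore] -/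
@[simp] theorem normPrimeIdealCount_one : normPrimeIdealCount K 1 = 0 := by
  rw [normPrimeIdealCount, Set.ncard_eq_zero (finite_setOf_prime_absNorm_eq K 1)]
  ext P
  simp only [Set.mem_setOf_eq, Set.mem_empty_iff_false, iff_false, not_and]
  intro hP _ h1
  exact hP.ne_top (Ideal.absNorm_eq_one_iff.mp h1)

/-- `θ_K(x) = 0` for `x < 2` (only `n = 0, 1` occur, and `G(0) = G(1) = 0`). [folklore] -/
theorem chebyshevThetaIdeal_eq_zero_of_lt_two {x : ℝ} (hx : x < 2) :
    chebyshevThetaIdeal K x = 0 := by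
  unfold chebyshevThetaIdeal
  refine sum_eq_zero fun n hn => ?_
  have hn2 : n < 2 := by
    have h1 : ⌊x⌋₊ < 2 := (Nat.floor_lt' two_ne_zero).mpr hx
    have h2 := (mem_Icc.mp hn).2
    omega
  interval_cases n <;> simp

/-- `θ_K ≥ 0`. [folklore] -/
theorem chebyshevThetaIdeal_nonneg (x : ℝ) : 0 ≤ chebyshevThetaIdeal K x := by
  unfold chebyshevThetaIdeal
  refine sum_nonneg fun n _ => mul_nonneg (Nat.cast_nonneg _) (Real.log_natCast_nonneg n)

variable {K} in
/-- The fibre of the norm map over `n ≤ x` inside the prime ideals of norm `≤ x` has `G(n)`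
elements. [folklore] -/
theorem card_filter_primeIdealsLE_absNorm_eq {x : ℝ} {n : ℕ} (hn : (n : ℝ) ≤ x) :
    (((finite_primeIdealsLE K x).toFinset).filter (fun P => Ideal.absNorm P = n)).card =
      normPrimeIdealCount K n := by
  rw [normPrimeIdealCount, ← Set.ncard_coe_finset]
  congr 1
  ext P
  simp only [coe_filter, Set.Finite.mem_toFinset, primeIdealsLE, Set.mem_setOf_eq]
  constructor
  · rintro ⟨⟨h1, h2, -⟩, h4⟩
    exact ⟨h1, h2, h4⟩
  · rintro ⟨h1, h2, h3⟩
    exact ⟨⟨h1, h2, by rw [h3]; exact hn⟩, h3⟩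

variable {K} in
/-- Every prime ideal of norm `≤ x` has norm in `{0, …, ⌊x⌋}`. [folklore] -/
theorem absNorm_mem_Icc_of_mem_primeIdealsLE {x : ℝ} {P : Ideal (𝓞 K)}
    (hP : P ∈ (finite_primeIdealsLE K x).toFinset) : Ideal.absNorm P ∈ Icc 0 ⌊x⌋₊ := by
  rw [Set.Finite.mem_toFinset] at hP
  exact mem_Icc.mpr ⟨Nat.zero_le _, Nat.le_floor hP.2.2⟩

/-- `π_K(x) = ∑_{n ≤ x} G(n)` (counting prime ideals fibrewise over the norm; Landau 1903,
p. 669). The hypothesis `0 ≤ x` is kept for convenience (for `x < 0` both sides vanish).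
[cite: LandauMathAnn1903, §13 p. 669] -/
theorem primeIdealCount_eq_sum_normPrimeIdealCount {x : ℝ} (hx : 0 ≤ x) :
    primeIdealCount K x = ∑ n ∈ Icc 0 ⌊x⌋₊, normPrimeIdealCount K n := by
  classical
  rw [primeIdealCount, Set.ncard_eq_toFinset_card _ (finite_primeIdealsLE K x),
    card_eq_sum_card_fiberwise (f := fun P => Ideal.absNorm P) (t := Icc 0 ⌊x⌋₊)
      fun P hP => absNorm_mem_Icc_of_mem_primeIdealsLE hP]
  refine sum_congr rfl fun n hn => ?_
  convert card_filter_primeIdealsLE_absNorm_eq (K := K) (x := x) (n := n) ?_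
  exact (Nat.le_floor_iff hx).mp (mem_Icc.mp hn).2

/-- `θ_K(x) = ∑_{N𝔭 ≤ x} log N𝔭`, the sum over the nonzero prime ideals of norm at most `x`
(the defining sum `∑_{n ≤ x} G(n) log n` regrouped by norm; Landau 1903, p. 669). The hypothesis
`0 ≤ x` is kept for convenience (for `x < 0` both sides vanish).
[cite: LandauMathAnn1903, eq. (57) p. 669] -/
theorem chebyshevThetaIdeal_eq_sum_primeIdealsLE {x : ℝ} (hx : 0 ≤ x) :
    chebyshevThetaIdeal K x =
      ∑ P ∈ (finite_primeIdealsLE K x).toFinset, Real.log (Ideal.absNorm P) := by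
  classical
  rw [chebyshevThetaIdeal, ← sum_fiberwise_of_maps_to
    (g := fun P => Ideal.absNorm P) (t := Icc 0 ⌊x⌋₊) (s := (finite_primeIdealsLE K x).toFinset)
    fun P hP => absNorm_mem_Icc_of_mem_primeIdealsLE hP]
  refine sum_congr rfl fun n hn => ?_
  have hnx : (n : ℝ) ≤ x := (Nat.le_floor_iff hx).mp (mem_Icc.mp hn).2
  rw [← card_filter_primeIdealsLE_absNorm_eq hnx,
    sum_congr rfl fun P hP => by rw [(mem_filter.mp hP).2], sum_const, nsmul_eq_mul]

/-! ### Partial summation: `π_K` from `θ_K`, and `Li` by parts -/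

/-- Integrability of `θ_K(t)/(t log² t)` on `[2, x]` (as for Mathlib's
`Chebyshev.integrableOn_theta_div_id_mul_log_sq`). [folklore] -/
theorem integrableOn_chebyshevThetaIdeal_div (x : ℝ) :
    IntegrableOn (fun t ↦ chebyshevThetaIdeal K t / (t * Real.log t ^ 2)) (Set.Icc 2 x)
      volume := by
  have heq : (fun t ↦ chebyshevThetaIdeal K t / (t * Real.log t ^ 2)) =
      fun t ↦ (1 / (t * Real.log t ^ 2)) *
        ∑ n ∈ Icc 0 ⌊t⌋₊, (normPrimeIdealCount K n : ℝ) * Real.log n := by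
    ext t
    rw [chebyshevThetaIdeal, div_eq_mul_one_div, mul_comm]
  rw [heq]
  refine integrableOn_mul_sum_Icc _ (by norm_num) <| ContinuousOn.integrableOn_Icc fun t ht ↦
    ContinuousAt.continuousWithinAt ?_
  have h0 : t ≠ 0 := by linarith [ht.1]
  have h1 : t * Real.log t ^ 2 ≠ 0 :=
    mul_ne_zero h0 (pow_ne_zero _ (Real.log_ne_zero_of_pos_of_ne_one (by linarith [ht.1])
      (by linarith [ht.1])))
  fun_prop (disch := assumption)

/-- **Partial summation** (Landau 1903, §13, p. 669–670): for `x ≥ 2`,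
`π_K(x) = θ_K(x)/log x + ∫₂ˣ θ_K(t) dt/(t log² t)`. The case `K = ℚ` is Mathlib's
`Chebyshev.primeCounting_eq_theta_div_log_add_integral`, whose proof is followed here.
[cite: LandauMathAnn1903, §13 pp. 669–670] -/
theorem primeIdealCount_eq_theta_div_log_add_integral {x : ℝ} (hx : 2 ≤ x) :
    (primeIdealCount K x : ℝ) = chebyshevThetaIdeal K x / Real.log x +
      ∫ t in (2 : ℝ)..x, chebyshevThetaIdeal K t / (t * Real.log t ^ 2) := by
  have hx0 : (0 : ℝ) ≤ x := by linarith
  rw [primeIdealCount_eq_sum_normPrimeIdealCount K hx0]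
  push_cast
  set a : ℕ → ℝ := fun n ↦ (normPrimeIdealCount K n : ℝ) * Real.log n with ha
  trans ∑ n ∈ Icc 0 ⌊x⌋₊, (Real.log n)⁻¹ * a n
  · refine sum_congr rfl fun n _ ↦ ?_
    rcases Nat.lt_or_ge n 2 with h | h
    · interval_cases n <;> simp [a]
    · have : Real.log n ≠ 0 :=
        Real.log_ne_zero_of_pos_of_ne_one (by exact_mod_cast (by omega : 0 < n))
          (by exact_mod_cast (by omega : n ≠ 1))
      simp only [a]
      field_simp
  rw [sum_mul_eq_sub_integral_mul₁ a (f := fun t ↦ (Real.log t)⁻¹) (by simp [a]) (by simp [a]),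
    ← intervalIntegral.integral_of_le hx]
  · have int_deriv :
        ∫ u in (2 : ℝ)..x, deriv (fun x ↦ (Real.log x)⁻¹) u * ∑ k ∈ Icc 0 ⌊u⌋₊, a k =
        -∫ u in (2 : ℝ)..x, chebyshevThetaIdeal K u / (u * Real.log u ^ 2) := by
      rw [← intervalIntegral.integral_neg]
      refine intervalIntegral.integral_congr fun u _ ↦ ?_
      simp only [Real.deriv_inv_log_apply, chebyshevThetaIdeal, a]
      ring
    rw [int_deriv]
    simp only [chebyshevThetaIdeal, a]
    ring
  · -- Differentiability
    intro z ⟨_, _⟩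
    have : z ≠ 0 := by linarith
    have : Real.log z ≠ 0 := by apply Real.log_ne_zero_of_pos_of_ne_one <;> linarith
    fun_prop (disch := assumption)
  · -- Integrability of the derivative
    refine ContinuousOn.integrableOn_Icc fun z ⟨_, _⟩ ↦ ContinuousWithinAt.congr ?_
      (fun _ _ ↦ Real.deriv_inv_log_apply) Real.deriv_inv_log_apply
    have : z ≠ 0 := by linarith
    have : Real.log z ^ 2 ≠ 0 := by
      refine pow_ne_zero 2 <| Real.log_ne_zero_of_pos_of_ne_one ?_ ?_ <;> linarith
    exact ContinuousAt.continuousWithinAt <| by fun_prop (disch := assumption)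

/-- **`Li` by parts**: `Li(x) = x/log x − 2/log 2 + ∫₂ˣ dt/log² t` for `x ≥ 2`
(differentiate `t/log t`; Landau 1903, p. 664; Montgomery–Vaughan 2007, proof of Thm 6.9).
[folklore] -/
theorem offsetLogIntegral_eq_div_log_add_integral {x : ℝ} (hx : 2 ≤ x) :
    offsetLogIntegral x =
      x / Real.log x - 2 / Real.log 2 + ∫ t in (2 : ℝ)..x, 1 / Real.log t ^ 2 := by
  have hderiv : ∀ t ∈ Set.uIcc 2 x,
      HasDerivAt (fun t ↦ t / Real.log t) (1 / Real.log t - 1 / Real.log t ^ 2) t := by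
    intro t ht
    rw [Set.uIcc_of_le hx] at ht
    have ht0 : t ≠ 0 := by linarith [ht.1]
    have hlog : Real.log t ≠ 0 :=
      Real.log_ne_zero_of_pos_of_ne_one (by linarith [ht.1]) (by linarith [ht.1])
    refine ((hasDerivAt_id' t).div (Real.hasDerivAt_log ht0) hlog).congr_deriv ?_
    field_simp
  have hint1 : IntervalIntegrable (fun t ↦ 1 / Real.log t) volume 2 x := by
    refine ContinuousOn.intervalIntegrable fun t ht ↦ ContinuousAt.continuousWithinAt ?_
    rw [Set.uIcc_of_le hx] at ht
    have : Real.log t ≠ 0 :=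
      Real.log_ne_zero_of_pos_of_ne_one (by linarith [ht.1]) (by linarith [ht.1])
    have : t ≠ 0 := by linarith [ht.1]
    fun_prop (disch := assumption)
  have hint2 : IntervalIntegrable (fun t ↦ 1 / Real.log t ^ 2) volume 2 x :=
    Chebyshev.intervalIntegrable_one_div_log_sq (by norm_num) (by linarith)
  have h := intervalIntegral.integral_eq_sub_of_hasDerivAt hderiv (hint1.sub hint2)
  rw [intervalIntegral.integral_sub hint1 hint2] at h
  have h1 : offsetLogIntegral x = ∫ t in (2 : ℝ)..x, 1 / Real.log t := by
    simp only [offsetLogIntegral, one_div]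
  rw [h1]
  linarith

/-! ### The error term: from `θ_K(x) = x + O(x e^{−c√log x})` to `π_K(x) = Li(x) + O(x e^{−c'√log x})` -/

/-- `t ↦ e^{−a√log t}` is decreasing on `(0, ∞)` for `a ≥ 0`. [folklore] -/
private theorem exp_neg_sqrt_log_antitone {a s t : ℝ} (ha : 0 ≤ a) (hs : 0 < s) (hst : s ≤ t) :
    Real.exp (-a * Real.sqrt (Real.log t)) ≤ Real.exp (-a * Real.sqrt (Real.log s)) := by
  apply Real.exp_le_exp.mpr
  have := Real.sqrt_le_sqrt (Real.log_le_log hs hst)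
  nlinarith

/-- `t ↦ e^{−a√log t}` is interval integrable on intervals of positive reals (it is continuous
there). [folklore] -/
private theorem intervalIntegrable_exp_neg_sqrt_log (a : ℝ) {p q : ℝ} (hp : 0 < p) (hq : 0 < q) :
    IntervalIntegrable (fun t ↦ Real.exp (-a * Real.sqrt (Real.log t))) volume p q := by
  refine ContinuousOn.intervalIntegrable fun t ht ↦ ContinuousAt.continuousWithinAt ?_
  have : t ≠ 0 := by
    rcases Set.mem_uIcc.mp ht with h | h <;> linarith [h.1]
  fun_prop (disch := assumption)

/-- `∫₂ˣ e^{−a√log t} dt ≤ √x + x e^{−a√log √x}` (split at `max 2 √x`; the integrand is `≤ 1`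
and decreasing). [folklore] -/
private theorem integral_exp_neg_sqrt_log_le {a x : ℝ} (ha : 0 ≤ a) (hx : 2 ≤ x) :
    ∫ t in (2 : ℝ)..x, Real.exp (-a * Real.sqrt (Real.log t)) ≤
      Real.sqrt x + x * Real.exp (-a * Real.sqrt (Real.log (Real.sqrt x))) := by
  set g : ℝ → ℝ := fun t ↦ Real.exp (-a * Real.sqrt (Real.log t)) with hg
  set m : ℝ := max 2 (Real.sqrt x) with hm
  have h2m : 2 ≤ m := le_max_left _ _
  have hsm : Real.sqrt x ≤ m := le_max_right _ _
  have hsx : Real.sqrt x ≤ x := by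
    rw [Real.sqrt_le_left (by linarith)]
    nlinarith
  have hmx : m ≤ x := max_le hx hsx
  have hm2 : m - 2 ≤ Real.sqrt x := by
    rcases le_total 2 (Real.sqrt x) with h | h
    · rw [hm, max_eq_right h]
      linarith
    · rw [hm, max_eq_left h]
      linarith [Real.sqrt_nonneg x]
  have hint : ∀ p q : ℝ, 2 ≤ p → 2 ≤ q → IntervalIntegrable g volume p q := fun p q hp hq ↦
    intervalIntegrable_exp_neg_sqrt_log a (by linarith) (by linarith)
  rw [← intervalIntegral.integral_add_adjacent_intervals (hint 2 m le_rfl h2m)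
    (hint m x h2m (by linarith))]
  have h1 : ∫ t in (2 : ℝ)..m, g t ≤ Real.sqrt x := by
    calc ∫ t in (2 : ℝ)..m, g t ≤ ∫ _ in (2 : ℝ)..m, (1 : ℝ) := by
          refine intervalIntegral.integral_mono_on h2m (hint 2 m le_rfl h2m) (by simp)
            fun t _ ↦ ?_
          simp only [g]
          rw [Real.exp_le_one_iff]
          nlinarith [Real.sqrt_nonneg (Real.log t)]
      _ = m - 2 := by simp
      _ ≤ Real.sqrt x := hm2
  have h2 : ∫ t in m..x, g t ≤ x * g (Real.sqrt x) := by
    calc ∫ t in m..x, g t ≤ ∫ _ in m..x, g m := by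
          refine intervalIntegral.integral_mono_on hmx (hint m x h2m (by linarith)) (by simp)
            fun t ht ↦ ?_
          exact exp_neg_sqrt_log_antitone ha (by linarith) ht.1
      _ = (x - m) * g m := by simp
      _ ≤ x * g (Real.sqrt x) := by
          have hgm : g m ≤ g (Real.sqrt x) :=
            exp_neg_sqrt_log_antitone ha (Real.sqrt_pos.mpr (by linarith)) hsm
          have hg0 : 0 ≤ g m := Real.exp_nonneg _
          nlinarith
  linarith

variable {K} in
/-- **The error term carried through partial summation** (Landau 1903, §§13–14, pp. 669–670;
Montgomery–Vaughan 2007, proof of Theorem 8.9 via Theorem 6.9): if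
`|θ_K(x) − x| ≤ C x e^{−c√log x}` for all `x ≥ 2` (`c > 0`), then for all `x ≥ 2`
`|π_K(x) − Li(x)| ≤ C' x e^{−c'√log x}` with `c' = min (c/2) (1/4)` and
`C' = C/log 2 + (2/log 2) e^{1/4} + (C/log² 2)(e^{1/4} + 1)`.
[cite: LandauMathAnn1903, §§13–14 pp. 669–670] -/
theorem primeIdealCount_sub_offsetLogIntegral_le {c C : ℝ} (hc : 0 < c)
    (hθ : ∀ x : ℝ, 2 ≤ x →
      |chebyshevThetaIdeal K x - x| ≤ C * x * Real.exp (-c * Real.sqrt (Real.log x)))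
    {x : ℝ} (hx : 2 ≤ x) :
    |(primeIdealCount K x : ℝ) - offsetLogIntegral x| ≤
      (C / Real.log 2 + 2 / Real.log 2 * Real.exp (1 / 4) +
          C / Real.log 2 ^ 2 * (Real.exp (1 / 4) + 1)) *
        x * Real.exp (-min (c / 2) (1 / 4) * Real.sqrt (Real.log x)) := by
  set c' : ℝ := min (c / 2) (1 / 4) with hc'
  -- constants
  have hC : 0 ≤ C := by
    have h := (abs_nonneg _).trans (hθ 2 le_rfl)
    have h2 : 0 < (2 : ℝ) * Real.exp (-c * Real.sqrt (Real.log 2)) := by positivity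
    nlinarith
  have hx0 : 0 < x := by linarith
  have hlog2 : (0.6931471803 : ℝ) < Real.log 2 := Real.log_two_gt_d9
  have hL2 : 0 < Real.log 2 := by linarith
  have hL : Real.log 2 ≤ Real.log x := Real.log_le_log two_pos hx
  set L : ℝ := Real.log x with hLdef
  have hLpos : 0 < L := by linarith
  have hc'2 : 2 * c' ≤ c := by
    have := min_le_left (c / 2) (1 / 4)
    linarith
  have hc'c : c' ≤ c := by
    have := min_le_left (c / 2) (1 / 4)
    linarith
  have hc'4 : c' ≤ 1 / 4 := min_le_right _ _
  have hc'0 : 0 < c' := lt_min (by linarith) (by norm_num)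
  set g : ℝ := Real.exp (-c' * Real.sqrt L) with hgdef
  have hg0 : 0 < g := Real.exp_pos _
  have hxL : Real.exp L = x := by rw [hLdef]; exact Real.exp_log hx0
  have hsqrtL0 : 0 ≤ Real.sqrt L := Real.sqrt_nonneg _
  have hsqrtL : Real.sqrt L ≤ 1 + L := by
    rw [Real.sqrt_le_left (by linarith)]
    nlinarith
  -- (i) `1 ≤ x g` and (ii) `√x ≤ e^{1/4} x g`
  have hxg : x * g = Real.exp (L - c' * Real.sqrt L) := by
    rw [← hxL, hgdef, ← Real.exp_add]
    ring_nf
  have hxg1 : 1 ≤ x * g := by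
    rw [hxg]
    apply Real.one_le_exp
    nlinarith
  have hxg2 : Real.sqrt x ≤ Real.exp (1 / 4) * (x * g) := by
    have h1 : Real.sqrt x = Real.exp (L / 2) := by
      rw [← Real.log_sqrt hx0.le, Real.exp_log (Real.sqrt_pos.mpr hx0)]
    rw [h1, hxg, ← Real.exp_add, Real.exp_le_exp]
    nlinarith
  -- decomposition of `π_K − Li`
  have hintθ : IntervalIntegrable (fun t ↦ chebyshevThetaIdeal K t / (t * Real.log t ^ 2))
      volume 2 x := by
    rw [intervalIntegrable_iff, Set.uIoc_of_le hx, ← integrableOn_Icc_iff_integrableOn_Ioc]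
    exact integrableOn_chebyshevThetaIdeal_div K x
  have hint2 : IntervalIntegrable (fun t ↦ 1 / Real.log t ^ 2) volume 2 x :=
    Chebyshev.intervalIntegrable_one_div_log_sq (by norm_num) (by linarith)
  set E : ℝ → ℝ := fun t ↦
    chebyshevThetaIdeal K t / (t * Real.log t ^ 2) - 1 / Real.log t ^ 2 with hE
  have hEint : IntervalIntegrable E volume 2 x := hintθ.sub hint2
  have hdecomp : (primeIdealCount K x : ℝ) - offsetLogIntegral x =
      (chebyshevThetaIdeal K x - x) / L + 2 / Real.log 2 + ∫ t in (2 : ℝ)..x, E t := by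
    rw [primeIdealCount_eq_theta_div_log_add_integral K hx,
      offsetLogIntegral_eq_div_log_add_integral hx, hE, intervalIntegral.integral_sub hintθ hint2,
      hLdef]
    ring
  -- pointwise bound on `E`
  have hEle : ∀ t ∈ Set.Icc 2 x,
      |E t| ≤ C / Real.log 2 ^ 2 * Real.exp (-(2 * c') * Real.sqrt (Real.log t)) := by
    intro t ht
    have ht0 : 0 < t := by linarith [ht.1]
    have hlt : Real.log 2 ≤ Real.log t := Real.log_le_log two_pos ht.1
    have hlt0 : 0 < Real.log t := by linarith
    have hEt : E t = (chebyshevThetaIdeal K t - t) / (t * Real.log t ^ 2) := by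
      simp only [hE]
      field_simp
    rw [hEt, abs_div, abs_of_pos (by positivity : 0 < t * Real.log t ^ 2),
      div_le_iff₀ (by positivity)]
    calc |chebyshevThetaIdeal K t - t|
        ≤ C * t * Real.exp (-c * Real.sqrt (Real.log t)) := hθ t ht.1
      _ ≤ C * t * Real.exp (-(2 * c') * Real.sqrt (Real.log t)) := by
          refine mul_le_mul_of_nonneg_left (Real.exp_le_exp.mpr ?_) (mul_nonneg hC ht0.le)
          nlinarith [Real.sqrt_nonneg (Real.log t)]
      _ = C / Real.log 2 ^ 2 * Real.exp (-(2 * c') * Real.sqrt (Real.log t)) *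
            (t * Real.log 2 ^ 2) := by
          field_simp
      _ ≤ C / Real.log 2 ^ 2 * Real.exp (-(2 * c') * Real.sqrt (Real.log t)) *
            (t * Real.log t ^ 2) := by
          refine mul_le_mul_of_nonneg_left ?_ (by positivity)
          refine mul_le_mul_of_nonneg_left ?_ ht0.le
          exact pow_le_pow_left₀ hL2.le hlt 2
  -- the integral of the bound
  have hsqrt2 : Real.exp (-(2 * c') * Real.sqrt (Real.log (Real.sqrt x))) ≤ g := by
    rw [Real.log_sqrt hx0.le, hgdef, Real.exp_le_exp]
    have h : Real.sqrt L ≤ 2 * Real.sqrt (L / 2) := by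
      rw [Real.sqrt_le_iff]
      refine ⟨by positivity, ?_⟩
      rw [mul_pow, Real.sq_sqrt (by linarith)]
      linarith
    nlinarith [Real.sqrt_nonneg (L / 2)]
  have hI : |∫ t in (2 : ℝ)..x, E t| ≤ C / Real.log 2 ^ 2 * (Real.sqrt x + x * g) := by
    calc |∫ t in (2 : ℝ)..x, E t|
        ≤ ∫ t in (2 : ℝ)..x, |E t| := intervalIntegral.abs_integral_le_integral_abs hx
      _ ≤ ∫ t in (2 : ℝ)..x, C / Real.log 2 ^ 2 * Real.exp (-(2 * c') * Real.sqrt (Real.log t)) :=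
          intervalIntegral.integral_mono_on hx hEint.abs
            ((intervalIntegrable_exp_neg_sqrt_log _ two_pos hx0).const_mul _) hEle
      _ = C / Real.log 2 ^ 2 * ∫ t in (2 : ℝ)..x, Real.exp (-(2 * c') * Real.sqrt (Real.log t)) :=
          intervalIntegral.integral_const_mul _ _
      _ ≤ C / Real.log 2 ^ 2 *
            (Real.sqrt x + x * Real.exp (-(2 * c') * Real.sqrt (Real.log (Real.sqrt x)))) :=
          mul_le_mul_of_nonneg_left (integral_exp_neg_sqrt_log_le (by linarith) hx)
            (by positivity)
      _ ≤ C / Real.log 2 ^ 2 * (Real.sqrt x + x * g) := by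
          refine mul_le_mul_of_nonneg_left ?_ (by positivity)
          exact add_le_add le_rfl (mul_le_mul_of_nonneg_left hsqrt2 hx0.le)
  -- the boundary term
  have hB : |(chebyshevThetaIdeal K x - x) / L| ≤ C / Real.log 2 * (x * g) := by
    rw [abs_div, abs_of_pos hLpos, div_le_iff₀ hLpos]
    calc |chebyshevThetaIdeal K x - x| ≤ C * x * Real.exp (-c * Real.sqrt L) := hθ x hx
      _ ≤ C * x * g := by
          refine mul_le_mul_of_nonneg_left (Real.exp_le_exp.mpr ?_) (mul_nonneg hC hx0.le)
          nlinarith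
      _ = C / Real.log 2 * (x * g) * Real.log 2 := by field_simp
      _ ≤ C / Real.log 2 * (x * g) * L := by
          refine mul_le_mul_of_nonneg_left hL ?_
          exact mul_nonneg (div_nonneg hC hL2.le) (by positivity)
  -- assemble
  rw [hdecomp]
  have hexp4 : 1 ≤ Real.exp (1 / 4) := Real.one_le_exp (by norm_num)
  have h1 : (1 : ℝ) ≤ Real.exp (1 / 4) * (x * g) := by nlinarith
  calc |(chebyshevThetaIdeal K x - x) / L + 2 / Real.log 2 + ∫ t in (2 : ℝ)..x, E t|
      ≤ |(chebyshevThetaIdeal K x - x) / L| + |2 / Real.log 2| + |∫ t in (2 : ℝ)..x, E t| :=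
        abs_add_three _ _ _
    _ ≤ C / Real.log 2 * (x * g) + 2 / Real.log 2 * (Real.exp (1 / 4) * (x * g)) +
          C / Real.log 2 ^ 2 * (Real.exp (1 / 4) * (x * g) + x * g) := by
        refine add_le_add_three hB ?_ (hI.trans ?_)
        · rw [abs_of_pos (by positivity)]
          exact le_mul_of_one_le_right (by positivity) h1
        · exact mul_le_mul_of_nonneg_left (add_le_add hxg2 le_rfl) (by positivity)
    _ = (C / Real.log 2 + 2 / Real.log 2 * Real.exp (1 / 4) +
          C / Real.log 2 ^ 2 * (Real.exp (1 / 4) + 1)) * x * g := by ring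

/-! ### The named fact and the reduction of the prime ideal theorem to it -/

/-- **The prime ideal theorem for `θ_K`, with de la Vallée-Poussin error term** (NAMED FACT).
For every number field `K` there are constants `c_K > 0` and `C_K` such that for all `x ≥ 2`,
`|θ_K(x) − x| ≤ C_K · x · exp(−c_K √log x)`, where `θ_K(x) = ∑_{N𝔭 ≤ x} log N𝔭`.
This is the `θ`-form of Montgomery–Vaughan's Theorem 8.9 (obtained "continuing as in Chapter 6",
i.e. as their Theorem 6.9, from the zero-free region `σ > 1 − c/log τ` for `ζ_K`, p. 267);
Landau 1903, eq. (57), p. 669, proves the weaker `ϑ_κ(x) = x + O(x e^{−(log x)^{1/γ}})`.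
Constants depend on `K` only; `K : Type` as in `primeIdealTheorem`.
[cite: MontgomeryVaughan2007, Thm 8.9 (p. 267) with Thm 6.9] -/
def chebyshevThetaPrimeIdealTheorem : Prop :=
  ∀ (K : Type) [Field K] [NumberField K],
    ∃ c : ℝ, 0 < c ∧ ∃ C : ℝ, ∀ x : ℝ, 2 ≤ x →
      |chebyshevThetaIdeal K x - x| ≤ C * x * Real.exp (-c * Real.sqrt (Real.log x))

/-- **Landau's last step**: the `θ_K`-form of the prime ideal theorem with error term implies
`primeIdealTheorem` (`π_K(x) = Li(x) + O_K(x e^{−c√log x})`), by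
`primeIdealCount_sub_offsetLogIntegral_le` (Landau 1903, §§13–14; Montgomery–Vaughan 2007,
Thm 8.9). [cite: LandauMathAnn1903, §§13–14 pp. 669–670] -/
theorem primeIdealTheorem_of_chebyshevTheta (h : chebyshevThetaPrimeIdealTheorem) :
    primeIdealTheorem := by
  intro K _ _
  obtain ⟨c, hc, C, hθ⟩ := h K
  exact ⟨min (c / 2) (1 / 4), lt_min (by linarith) (by norm_num), _,
    fun x hx ↦ primeIdealCount_sub_offsetLogIntegral_le hc hθ hx⟩

end Literature.NumberTheory.LFunctions.NumberField

end
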